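import Summits.CriticalPhenomena.PercolationContinuityZ3.Theorems.PercNearOneGluingNoHeavyLowerTailSahiGridPatternDiagCertLiteralOr

/-!
# `NoHeavyLowerTail` (crux stmt-CriticalPhenomena-4575), Sahi programme P1: **THE LITERAL-OR (N′) IDENTITY FOR ARBITRARY SECTION TRIPLES**

Support file (Sahi cell, seat `prim-sahi-p1`, generation 36; `--supports stmt-CriticalPhenomena-4575`).  Pure proofs, no definitions, no `sorry`, standard axioms.
Vocabulary of `…SahiGridPattern{,SliceForm,Kleitman,DiagCertLiteralOr}` (`Pd`, `ind`, `TotDist`, `thirdPt`, `nuCount`, `pairSum_eq_of_sym6_eq`).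

THE MATHEMATICS.  `…DiagCertLiteralOr.diagCert_literalOneOr_N` proves condition (N′) for the certificate `(2^{k+1}1_V ; 2^{k+1}+h_V ; 2^{k+1}+h_V)` of
`A = {x₀ ≥ 1} ∨ V` through a twelve-column identity (four Kleitman sums, four coefficientwise-Harris sums, four pointwise products) valid after Latin-role
symmetrisation; there the three levels `B₀ ⊆ B₁ ⊆ B₂`, `C₀ ⊆ C₁ ⊆ C₂` are the sections of up-sets `B, C ⊆ [3]^{1+k}` and the identity is hidden inside the proof.
THIS FILE states the identity ITSELF, as an EQUALITY of integers, for SEVEN ARBITRARY finsets `B₀, B₁, B₂, C₀, C₁, C₂, V ⊆ [3]^k` (no nesting, no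
monotonicity): with `[q δ̸ r]` the total-distinctness indicator, `q̄r = thirdPt q r`,
  `Θ_LO(B,C) := Σ_{q δ̸ r} [ 1_{B₀∩V}(q)1_{C₁}(r) + 1_{B₀∩V}(q)1_{C₂}(r) + 1_{B₁}(q)1_{C₀∩V}(r) + 1_{B₂}(q)1_{C₀∩V}(r) + (1_{B₁}(q)1_{C₂}(r) + 1_{B₂}(q)1_{C₁}(r))(2 − 1_V(q̄r)) ]`
(the off-diagonal kernel `Θ_A(B×C)` of the literal-OR set written on the level sections) and the budget
  `d′(B∩C) := Σ_q [ 2^{k+1}1_V 1_{B₀}1_{C₀} + (2^{k+1} + 2^k 1_V − ν_V)(1_{B₁}1_{C₁} + 1_{B₂}1_{C₂}) ](q)`,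
**THEOREM (`literalOneOr_pair_identity`, `literalOneOr_budget_sub_theta_eq`):**
  `d′(B∩C) − Θ_LO(B,C) = K₁ + K₂ + K₃ + K₄ + H₁ + H₂ + H₃ + H₄ + P₁ + P₂ + P₃ + P₄`
with the twelve columns written out as explicit double sums (`K₁ = Σ_{q δ̸ r} 1_{B₁}(r)(1_{C₂}(r) − 1_{C₂}(q̄r))`, …, `P₄ = Σ_{q δ̸ r}(1 − 1_V(q))(1_{B₂} − 1_{B₁})(r)
(1_{C₂} − 1_{C₁})(q̄r)`).  Each column is `≥ 0` WHEN the sets are up-sets with the nesting used in `…DiagCertLiteralOr` (Kleitman, Harris, monotonicity); the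
identity itself needs nothing.  USE (seat memo FROM-prim-sahi-p1-gen36 §2.2): the certificate vector OR8(4·1_T; V, d_V) of the two-payer star `(x∧y) ∨ V` is,
cell by cell, the sum over the six outer Latin lines of the LO / T1 certificates, and its (N)-slack is the sum of six such line identities evaluated on section
triples that are NOT nested along four of the lines — which is why the identity is needed in this generality.  Nothing here asserts `PatternPos d` for `d ≥ 4`
or condition (N) for any block. [this work]
-/

namespace Summit.CriticalPhenomena.PercolationContinuityZ3.Theorems.SahiGridPattern

open Finset SahiGrid3
open scoped BigOperators

variable {k : ℕ}

/-- **The literal-OR (N′) identity in pair-sum form, for arbitrary finsets** `B₀ B₁ B₂ C₀ C₁ C₂ V ⊆ [3]^k`: the kernel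
`2·1_V1_{B₀}1_{C₀}(q) + (2 + 1_V(q) − 1_V(r))(1_{B₁}1_{C₁} + 1_{B₂}1_{C₂})(q) − [Θ_LO kernel](q,r)` and the twelve-column kernel have the same sum over
totally distinct pairs. [this work] -/
theorem literalOneOr_pair_identity (B0 B1 B2 C0 C1 C2 V : Finset (Pd k)) :
    (∑ q : Pd k, ∑ r : Pd k, (if TotDist q r = true then (1:ℤ) else 0) *
      ( 2 * ind V q * ind B0 q * ind C0 q + (2 + ind V q - ind V r) * (ind B1 q * ind C1 q + ind B2 q * ind C2 q)
        - ( ind B0 q * ind V q * ind C1 r + ind B0 q * ind V q * ind C2 r + ind B1 q * ind C0 r * ind V r + ind B2 q * ind C0 r * ind V r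
            + (ind B1 q * ind C2 r + ind B2 q * ind C1 r) * (2 - ind V (thirdPt q r)) ) ))
    = ∑ q : Pd k, ∑ r : Pd k, (if TotDist q r = true then (1:ℤ) else 0) *
      ( (ind B1 r * (ind C2 r - ind C2 (thirdPt q r)))
      + (ind B2 r * (ind C1 r - ind C1 (thirdPt q r)))
      + (1 - ind V q) * (ind B2 r * (ind C2 r - ind C2 (thirdPt q r)))
      + (1 - ind V q) * (ind B1 r * (ind C1 r - ind C1 (thirdPt q r)))
      + ind B1 q * (ind C0 q * ind V q - ind C0 r * ind V r)
      + ind B2 q * (ind C0 q * ind V q - ind C0 r * ind V r)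
      + ind C1 q * (ind B0 q * ind V q - ind B0 r * ind V r)
      + ind C2 q * (ind B0 q * ind V q - ind B0 r * ind V r)
      + (ind B2 q - ind B1 q) * (ind C2 q - ind C1 q)
      + ind V q * ((ind B1 q - ind B0 q) * (ind C1 q - ind C0 q))
      + ind V q * ((ind B2 q - ind B0 q) * (ind C2 q - ind C0 q))
      + (1 - ind V q) * ((ind B2 r - ind B1 r) * (ind C2 (thirdPt q r) - ind C1 (thirdPt q r))) ) := by
  obtain ⟨c1, c2, c3, c4⟩ := And.intro (fun q r => (thirdPt_cancel (k := k) q r).1) (And.intro (fun q r => (thirdPt_cancel (k := k) q r).2.1)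
    (And.intro (fun q r => (thirdPt_cancel (k := k) q r).2.2.1) (fun q r => (thirdPt_cancel (k := k) q r).2.2.2)))
  exact pairSum_eq_of_sym6_eq _ _ (fun q r => by simp only [c1, c2, c3, c4, thirdPt_comm r q]; ring)

/-- `Σ_q 2^k·F(q) = Σ_q Σ_r [q δ̸ r]·F(q)` (every point has `2^k` totally distinct partners). [this work] -/
theorem sum_two_pow_mul_eq_pairSum (F : Pd k → ℤ) :
    (∑ q : Pd k, (2:ℤ) ^ k * F q) = ∑ q : Pd k, ∑ r : Pd k, (if TotDist q r = true then (1:ℤ) else 0) * F q := by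
  refine Finset.sum_congr rfl fun q _ => ?_
  rw [← Finset.sum_mul, sum_ite_totDist_eq_two_pow]

/-- `ν_V(q)·F(q) = Σ_r [q δ̸ r]·1_V(r)·F(q)`. [this work] -/
theorem nuCount_mul_eq_pairSum (V : Finset (Pd k)) (F : Pd k → ℤ) (q : Pd k) :
    (nuCount V q : ℤ) * F q = ∑ r : Pd k, (if TotDist q r = true then (1:ℤ) else 0) * (ind V r * F q) := by
  rw [nuCount_eq_sum_ind, Finset.sum_mul]
  refine Finset.sum_congr rfl fun r _ => ?_
  rw [totDist_symm r q]; ring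

/-- **The literal-OR (N′) identity, budget form** (arbitrary finsets): `d′(B∩C) − Θ_LO(B,C)` — budget as a point sum with `2^{k+1}`, `2^k1_V`, `ν_V`, the
off-diagonal kernel as the six explicit pair sums — equals the twelve-column pair sum of `literalOneOr_pair_identity`. [this work] -/
theorem literalOneOr_budget_sub_theta_eq (B0 B1 B2 C0 C1 C2 V : Finset (Pd k)) :
    (∑ q : Pd k, (2 * 2 ^ k * ind V q * ind B0 q * ind C0 q
        + (2 * 2 ^ k + 2 ^ k * ind V q - (nuCount V q : ℤ)) * (ind B1 q * ind C1 q + ind B2 q * ind C2 q)))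
    - (∑ q : Pd k, ∑ r : Pd k, (if TotDist q r = true then (1:ℤ) else 0) *
        ( ind B0 q * ind V q * ind C1 r + ind B0 q * ind V q * ind C2 r + ind B1 q * ind C0 r * ind V r + ind B2 q * ind C0 r * ind V r
          + (ind B1 q * ind C2 r + ind B2 q * ind C1 r) * (2 - ind V (thirdPt q r)) ))
    = ∑ q : Pd k, ∑ r : Pd k, (if TotDist q r = true then (1:ℤ) else 0) *
      ( (ind B1 r * (ind C2 r - ind C2 (thirdPt q r)))
      + (ind B2 r * (ind C1 r - ind C1 (thirdPt q r)))
      + (1 - ind V q) * (ind B2 r * (ind C2 r - ind C2 (thirdPt q r)))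
      + (1 - ind V q) * (ind B1 r * (ind C1 r - ind C1 (thirdPt q r)))
      + ind B1 q * (ind C0 q * ind V q - ind C0 r * ind V r)
      + ind B2 q * (ind C0 q * ind V q - ind C0 r * ind V r)
      + ind C1 q * (ind B0 q * ind V q - ind B0 r * ind V r)
      + ind C2 q * (ind B0 q * ind V q - ind B0 r * ind V r)
      + (ind B2 q - ind B1 q) * (ind C2 q - ind C1 q)
      + ind V q * ((ind B1 q - ind B0 q) * (ind C1 q - ind C0 q))
      + ind V q * ((ind B2 q - ind B0 q) * (ind C2 q - ind C0 q))
      + (1 - ind V q) * ((ind B2 r - ind B1 r) * (ind C2 (thirdPt q r) - ind C1 (thirdPt q r))) ) := by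
  rw [← literalOneOr_pair_identity B0 B1 B2 C0 C1 C2 V]
  -- budget point sum → pair sum
  have hb : ∀ q : Pd k, (2 * 2 ^ k * ind V q * ind B0 q * ind C0 q
        + (2 * 2 ^ k + 2 ^ k * ind V q - (nuCount V q : ℤ)) * (ind B1 q * ind C1 q + ind B2 q * ind C2 q))
      = ∑ r : Pd k, (if TotDist q r = true then (1:ℤ) else 0) *
          (2 * ind V q * ind B0 q * ind C0 q + (2 + ind V q - ind V r) * (ind B1 q * ind C1 q + ind B2 q * ind C2 q)) := by
    intro q
    have e1 : (2:ℤ) ^ k * (2 * ind V q * ind B0 q * ind C0 q + (2 + ind V q) * (ind B1 q * ind C1 q + ind B2 q * ind C2 q))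
        = ∑ r : Pd k, (if TotDist q r = true then (1:ℤ) else 0) * (2 * ind V q * ind B0 q * ind C0 q + (2 + ind V q) * (ind B1 q * ind C1 q + ind B2 q * ind C2 q)) := by
      rw [← Finset.sum_mul, sum_ite_totDist_eq_two_pow]
    have e2 := nuCount_mul_eq_pairSum V (fun q => ind B1 q * ind C1 q + ind B2 q * ind C2 q) q
    have e3 : (∑ r : Pd k, (if TotDist q r = true then (1:ℤ) else 0) *
          (2 * ind V q * ind B0 q * ind C0 q + (2 + ind V q - ind V r) * (ind B1 q * ind C1 q + ind B2 q * ind C2 q)))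
        = (∑ r : Pd k, (if TotDist q r = true then (1:ℤ) else 0) * (2 * ind V q * ind B0 q * ind C0 q + (2 + ind V q) * (ind B1 q * ind C1 q + ind B2 q * ind C2 q)))
          - ∑ r : Pd k, (if TotDist q r = true then (1:ℤ) else 0) * (ind V r * (ind B1 q * ind C1 q + ind B2 q * ind C2 q)) := by
      rw [← Finset.sum_sub_distrib]
      refine Finset.sum_congr rfl fun r _ => ?_
      ring
    rw [e3, ← e1, ← e2]
    ring
  rw [Finset.sum_congr rfl fun q _ => hb q, ← Finset.sum_sub_distrib]
  refine Finset.sum_congr rfl fun q _ => ?_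
  rw [← Finset.sum_sub_distrib]
  refine Finset.sum_congr rfl fun r _ => ?_
  ring

end Summit.CriticalPhenomena.PercolationContinuityZ3.Theorems.SahiGridPattern
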